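import Summits.ABC.ABC.Theses.RootDecompH
import HarnessLib

/-!
# Route RootDecompH — split glue `NLFOfTower` (item stmt-ABC-30282)

`TowerCeiling → TowerWindowFloor → NontrivialLevelFloor` (`Summit.ABC.ABC.Theses.RootDecompH.NLFOfTower`):
the tower ceiling gives `λ, K'` and a threshold `p₁` beyond which every abc triple with a `p`-th power
tower has its `p`-full part in the window `F_p^p ≤ K'·N_p^λ`; the window floor at `(λ, K', ε)` gives
`p₂, K`; take `p₀ := max p₁ p₂` — modus ponens (lens-2 gen-8 TowerCeiling, kernel `glueW1_holds`;
cell decomp-abc writer LANDING LIST, door H).  Bookkeeping only (size S); proves neither `ABC` nor any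
crux.
-/

set_option linter.dupNamespace false

namespace Summit.ABC.ABC.Theorems

/-- Item stmt-ABC-30282, literally the route decl `RootDecompH.NLFOfTower`. -/
theorem rootDecompH_nlfOfTower_proof : Summit.ABC.ABC.Theses.RootDecompH.NLFOfTower := by
  unfold Summit.ABC.ABC.Theses.RootDecompH.NLFOfTower Summit.ABC.ABC.Theses.RootDecompH.TowerCeiling
    Summit.ABC.ABC.Theses.RootDecompH.TowerWindowFloor
    Summit.ABC.ABC.Theses.RootDecompH.NontrivialLevelFloor
  rintro ⟨lam, K', hlam, hK', p₁, hTC⟩ hTWF ε hε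
  obtain ⟨p₂, K, hK, hW⟩ := hTWF lam K' hlam hK' ε hε
  refine ⟨max p₁ p₂, K, hK, fun p hp hp₀ a b c ht htow => ?_⟩
  exact hW p hp (le_of_max_le_right hp₀) a b c ht htow
    (hTC p hp (le_of_max_le_left hp₀) a b c ht htow)

end Summit.ABC.ABC.Theorems
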